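import Summits.AtomisticToContinuum.Crystallization.Theorems.ThreeConeCertificateSlackRigidityRodDefs
import Mathlib.Analysis.Fourier.FourierTransform
import Mathlib.MeasureTheory.Measure.Haar.InnerProductSpace
import Mathlib.MeasureTheory.Constructions.Pi
import Mathlib.Analysis.SpecialFunctions.JapaneseBracket
import HarnessLib

/-!
# Fourier slice along the `(10)` rod
(line `signed-root-silent-field`, crux `ThreeConeCertificate.SlackRigidity`,
stmt-AtomisticToContinuum-11960, stub `stub_rodSlice`)

For a continuous radial kernel profile `K : ℝ → ℝ` with `|K(r)| ≤ C_K (1+r)⁻⁴` (so that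
`y ↦ K(|y|)` is integrable on `ℝ³`, `3 < 4`), the 1-D Fourier transform of the ROD PROFILE
`c_G(t) = rodProfile a K t = ∫_{ℝ²} K(√(|u|² + t²)) e^{−2πi⟨u,G⟩} du` (`G = rodDual a`) is the
3-D Fourier transform of `y ↦ K(|y|)` restricted to the `(10)` rod `ξ₃ ↦ rodPoint a ξ₃ = (G, ξ₃)`:

  `𝓕₁ (rodProfile a K) ξ₃ = 𝓕₃ (y ↦ K |y|) (rodPoint a ξ₃)`        (`stub_rodSlice`).

This is the FOURIER SLICE (projection–slice) identity, and its proof is Fubini through the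
volume-preserving identification `ℝ³ ≃ ℝ × ℝ²`, `y ↦ (y₂, (y₀, y₁))` (built inside the proof of
`integral_eq_integral_integral_slice` from Mathlib's `MeasurableEquiv.piFinSuccAbove` at the
index `2` and the volume-preserving identifications `EuclideanSpace ℝ (Fin n) ≃ (Fin n → ℝ)`; no
new definition is introduced, the slices are written `toLp 2 ![w 0, w 1, z]`), together with the
two pointwise identities `|(w, z)| = √(|w|² + z²)` (`norm_toLp_slice`) and
`⟨(w, z), rodPoint a ξ₃⟩ = ⟨w, G⟩ + z ξ₃` (`inner_toLp_slice_rodPoint`).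

All `[folklore]` (Fubini; Stein–Weiss, *Introduction to Fourier Analysis on Euclidean Spaces*,
Ch. I §1).  The splitting and its coordinate bookkeeping are adapted from
`Literature/Analysis/FluidPDE/CylindricalIntegration.lean` (`cylSplit`), which is not imported so as
to keep the dependency cone of the crux small.
-/

noncomputable section

open scoped BigOperators Topology FourierTransform RealInnerProductSpace
open MeasureTheory Filter Set Metric WithLp
open Literature.MathematicalPhysics.StatisticalMechanics
open Summit.AtomisticToContinuum.Crystallization.Theorems.SlackRigidityNegative (E3)
open Summit.AtomisticToContinuum.Crystallization.Theorems.SignedRootSilentField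
  (E2 rodDual rodPoint rodProfile rodProfile_def rodPoint_apply_zero rodPoint_apply_one
    rodPoint_apply_two rodDual_apply_zero rodDual_apply_one)

namespace Summit.AtomisticToContinuum.Crystallization.Theorems.SignedRootSlice

/-! ### Fubini through the splitting `ℝ³ ≃ᵐ ℝ × ℝ²`, `y ↦ (y₂, (y₀, y₁))` -/

-- adapted from Literature/Analysis/FluidPDE/CylindricalIntegration.lean (`cylSplit`,
-- `measurePreserving_cylSplit`, `integral_eq_integral_integral_cylSplit`)

/-- **Fubini in the split variables**: `∫_{ℝ³} G = ∫ dz ∫_{ℝ²} dw G (w₀, w₁, z)` for integrable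
`G : ℝ³ → ℂ`.  The splitting `ℝ³ ≃ᵐ ℝ × ℝ²`, `y ↦ (y₂, (y₀, y₁))`, is the composition of the
volume-preserving identification `ℝ³ ≃ (Fin 3 → ℝ)`
(`EuclideanSpace.volume_preserving_symm_measurableEquiv_toLp`), Mathlib's
`MeasurableEquiv.piFinSuccAbove` at the index `2` (`volume_preserving_piFinSuccAbove`) and
`(Fin 2 → ℝ) ≃ ℝ²` on the second factor (`PiLp.volume_preserving_toLp`); its inverse sends
`(z, w)` to `toLp 2 ![w 0, w 1, z]`. [folklore] -/
theorem integral_eq_integral_integral_slice {G : E3 → ℂ} (hG : Integrable G) :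
    ∫ y, G y = ∫ z : ℝ, ∫ w : E2, G (toLp 2 ![w 0, w 1, z]) := by
  -- the splitting, volume-preserving, with forward map `(w₀, w₁, z) ↦ (z, w)`
  obtain ⟨e, hmp, happly⟩ : ∃ e : E3 ≃ᵐ ℝ × E2, MeasurePreserving e volume volume ∧
      ∀ (z : ℝ) (w : E2), e (toLp 2 ![w 0, w 1, z]) = (z, w) := by
    refine ⟨((MeasurableEquiv.toLp 2 (Fin 3 → ℝ)).symm.trans
      (MeasurableEquiv.piFinSuccAbove (fun _ => ℝ) 2)).trans
      (MeasurableEquiv.prodCongr (MeasurableEquiv.refl ℝ) (MeasurableEquiv.toLp 2 (Fin 2 → ℝ))),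
      ?_, fun z w => Prod.ext rfl ?_⟩
    · have h1 : MeasurePreserving (MeasurableEquiv.toLp 2 (Fin 3 → ℝ)).symm volume volume :=
        EuclideanSpace.volume_preserving_symm_measurableEquiv_toLp (Fin 3)
      have h2 : MeasurePreserving (MeasurableEquiv.piFinSuccAbove (fun _ : Fin 3 => ℝ) 2) volume
          volume :=
        volume_preserving_piFinSuccAbove (fun _ => ℝ) 2
      have h3 : MeasurePreserving (MeasurableEquiv.prodCongr (MeasurableEquiv.refl ℝ)
          (MeasurableEquiv.toLp 2 (Fin 2 → ℝ))) volume volume :=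
        (MeasurePreserving.id volume).prod (PiLp.volume_preserving_toLp (Fin 2))
      exact (h1.trans h2).trans h3
    · ext j
      fin_cases j <;> rfl
  -- hence the inverse sends `(z, w)` to `(w₀, w₁, z)`
  have hsymm : ∀ (z : ℝ) (w : E2), e.symm (z, w) = toLp 2 ![w 0, w 1, z] := fun z w => by
    apply e.injective
    rw [MeasurableEquiv.apply_symm_apply, happly]
  have hmp' : MeasurePreserving e.symm volume volume := hmp.symm _
  rw [← hmp'.integral_comp e.symm.measurableEmbedding G]
  refine (integral_prod _ ((hmp'.integrable_comp_emb e.symm.measurableEmbedding).2 hG)).trans ?_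
  simp only [Function.comp_apply, hsymm]

/-- The Euclidean norm in the split variables: `|(w₀, w₁, z)| = √(|w|² + z²)`. [folklore] -/
theorem norm_toLp_slice (z : ℝ) (w : E2) :
    ‖(toLp 2 ![w 0, w 1, z] : E3)‖ = Real.sqrt (‖w‖ ^ 2 + z ^ 2) := by
  rw [EuclideanSpace.norm_eq (toLp 2 ![w 0, w 1, z] : E3), EuclideanSpace.norm_eq w,
    Real.sq_sqrt (Finset.sum_nonneg fun i _ => sq_nonneg _), Fin.sum_univ_three, Fin.sum_univ_two]
  simp [Real.norm_eq_abs, sq_abs]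

/-- The phase in the split variables: `⟨(w₀, w₁, z), rodPoint a ξ₃⟩ = ⟨w, rodDual a⟩ + z ξ₃`
(`rodPoint a ξ₃ = (rodDual a, ξ₃)`). [folklore] -/
theorem inner_toLp_slice_rodPoint (a ξ₃ z : ℝ) (w : E2) :
    ⟪(toLp 2 ![w 0, w 1, z] : E3), rodPoint a ξ₃⟫ = ⟪w, rodDual a⟫ + z * ξ₃ := by
  simp only [PiLp.inner_apply, Fin.sum_univ_three, Fin.sum_univ_two, RCLike.inner_apply,
    conj_trivial, Matrix.cons_val_zero, Matrix.cons_val_one, Matrix.cons_val_two,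
    Matrix.head_cons, Matrix.tail_cons, rodPoint_apply_zero, rodPoint_apply_one, rodPoint_apply_two,
    rodDual_apply_zero, rodDual_apply_one]
  ring

/-! ### Integrability of the radial kernel on `ℝ³` -/

/-- A continuous radial profile with `|K(r)| ≤ C_K (1+r)⁻⁴` gives an integrable `y ↦ K(|y|)` on
`ℝ³` (comparison with `C_K (1+|y|)⁻⁴`, integrable since `dim ℝ³ = 3 < 4`, Mathlib
`integrable_one_add_norm`). [folklore] -/
theorem integrable_radial {CK : ℝ} {K : ℝ → ℝ} (hKc : Continuous K)
    (hKd : ∀ r : ℝ, 0 ≤ r → |K r| ≤ CK / (1 + r) ^ 4) :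
    Integrable (fun y : E3 => (K ‖y‖ : ℂ)) := by
  have hint : Integrable (fun y : E3 => CK * (1 + ‖y‖) ^ (-(4 : ℝ))) := by
    refine (integrable_one_add_norm ?_).const_mul CK
    rw [finrank_euclideanSpace, Fintype.card_fin]
    norm_num
  refine hint.mono' ?_ (Eventually.of_forall fun y => ?_)
  · exact (Complex.continuous_ofReal.comp (hKc.comp continuous_norm)).aestronglyMeasurable
  · rw [Complex.norm_real, Real.norm_eq_abs]
    calc |K ‖y‖| ≤ CK / (1 + ‖y‖) ^ 4 := hKd _ (norm_nonneg y)
      _ = CK * (1 + ‖y‖) ^ (-(4 : ℝ)) := by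
        rw [Real.rpow_neg (by positivity), div_eq_mul_inv]
        norm_num

/-! ### The Fourier slice -/

/-- **Fourier slice along the `(10)` rod** (stub `stub_rodSlice` of line
`signed-root-silent-field`).  For a continuous kernel profile `K` with `|K(r)| ≤ C_K(1+r)⁻⁴`, the
1-D Fourier transform of the rod profile `t ↦ rodProfile a K t = 𝓕₂ (u ↦ K √(|u|²+t²)) (rodDual a)`
is the 3-D Fourier transform of `y ↦ K |y|` on the rod:
`𝓕₁ (rodProfile a K) ξ₃ = 𝓕₃ (y ↦ K |y|) (rodPoint a ξ₃)`.  Proof: unfold both sides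
(`Real.fourier_real_eq`, `Real.fourier_eq`), Fubini through the splitting
(`integral_eq_integral_integral_slice`; integrability from `integrable_radial` and
`Real.fourierIntegral_convergent_iff`), the norm and phase identities `norm_toLp_slice`,
`inner_toLp_slice_rodPoint`, and `𝐞(−(A + B)) = 𝐞(−A) 𝐞(−B)` to pull the height character out of
the planar integral (`integral_smul`). [folklore] -/
theorem stub_rodSlice :
  ∀ (a CK : ℝ) (K : ℝ → ℝ), Continuous K → (∀ r : ℝ, 0 ≤ r → |K r| ≤ CK / (1 + r) ^ 4) →
    ∀ ξ₃ : ℝ, 𝓕 (rodProfile a K) ξ₃ = 𝓕 (fun y : E3 => (K ‖y‖ : ℂ)) (rodPoint a ξ₃) := by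
  intro a CK K hKc hKd ξ₃
  rw [Real.fourier_real_eq, Real.fourier_eq]
  have hG : Integrable (fun v : E3 => 𝐞 (-⟪v, rodPoint a ξ₃⟫) • (K ‖v‖ : ℂ)) :=
    (Real.fourierIntegral_convergent_iff (rodPoint a ξ₃)).2 (integrable_radial hKc hKd)
  rw [integral_eq_integral_integral_slice hG]
  congr 1
  funext t
  simp only [inner_toLp_slice_rodPoint, norm_toLp_slice]
  rw [rodProfile_def, Real.fourier_eq]
  simp only [Circle.smul_def]
  rw [← integral_smul]
  congr 1
  funext u
  rw [neg_add, AddChar.map_add_eq_mul, Circle.coe_mul, mul_smul, smul_comm]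

end Summit.AtomisticToContinuum.Crystallization.Theorems.SignedRootSlice

end
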